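import Mathlib.MeasureTheory.Constructions.Cylinders
import Literature.Probability.LatticeModels.ONModelDobrushin
import Literature.Probability.LatticeModels.GibbsSpecificationDLRProofs
import HarnessLib

/-!
# Dobrushin uniqueness for the O(N) model at high temperature

Fourth file of the high-temperature analysis of the classical O(N) model. We instantiate the
abstract comparison argument of `DobrushinComparison.lean` with the single-site kernels of the
O(N) specification (`ONModelDobrushin.lean`) and derive **Dobrushin's uniqueness theorem for the
nearest-neighbour O(N) model** (Dobrushin 1968; Friedli–Velenik 2017, Thm. 6.31 with Thm. 6.35 /
Example 6.36; Georgii 2011, Thm. 8.7 with Prop. 8.8): on a locally finite graph with countable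
vertex set and degrees `≤ D`, if `D (e^{4|β|} - 1) < 1` then any two Gibbs measures of
`onSpecification G β` have the same expectations on bounded local measurable observables
(`integral_eq_of_isGibbsMeasure`) and hence coincide (`subsingleton_gibbsMeasures_onSpecification`).

## Contents

* `onDustingData G β W` — the dusting data: admissible observables = bounded measurable local
  functions, `T x = onSiteAvg G β x`, `C x y = (e^{4|β|} - 1) 𝟙[x ∼ y]` (`onDobrushinCoeff`),
  `nbr = neighborFinset`; the dusting estimate is `isOscBound_onSiteAvg`.
* three **invariant states** for these data (`Dobrushin.DustingData.IsInvariantState`):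
  the expectation under a Gibbs measure (`isInvariantState_integral_of_isGibbsMeasure`, DLR
  equations `μ γ_x = μ`, any `W`); the expectation under a finite-volume kernel `γ_{Λ'}(· | η₀)`
  with `W = Λ'` (`isInvariantState_integral_onSpecification`, consistency `γ_{Λ'} γ_x = γ_{Λ'}` for
  `x ∈ Λ'`, `IsSpecification.integral_integral_consistent`); and the expectation under a Gibbs
  measure tilted by a nonnegative local density `g`, with `W` the complement of the support of `g`
  (`isInvariantState_tilt`, properness). The last two feed the existence and the decay files.
* `sum_onDustingCoeff_le` — the row sums are `deg(x) (e^{4|β|} - 1) ≤ D (e^{4|β|} - 1)`.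
* `integral_eq_of_isGibbsMeasure`, `measure_eq_of_isGibbsMeasure`,
  `subsingleton_gibbsMeasures_onSpecification` — uniqueness.

## References

* R. L. Dobrushin, Theory Probab. Appl. 13 (1968) 197–224, Thm. 4 ff.
* S. Friedli, Y. Velenik, *Statistical Mechanics of Lattice Systems* (CUP 2017), Thm. 6.31,
  Thm. 6.35, Example 6.36, Lemma 6.22 (local functions determine the measure).
* H.-O. Georgii, *Gibbs Measures and Phase Transitions*, 2nd ed. (de Gruyter 2011), Thm. 8.7,
  Prop. 8.8.
-/

noncomputable section

open MeasureTheory ProbabilityTheory Finset Function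
open scoped ENNReal

namespace Literature.Probability.LatticeModels

variable {V : Type*} {N : ℕ}

/-! ### Consistency of a specification, integral form -/

section Consistency

variable {S : Type*} [MeasurableSpace S] {γ : Specification V S}

/-- **Consistency for observables** (Georgii 2011, Def. 1.23 (iii), `γ_{Λ'} γ_Λ = γ_{Λ'}`;
Friedli–Velenik 2017, Def. 6.9): for a specification, `Λ ⊆ Λ'` and a `γ_{Λ'}(· | η)`-integrable
`f`, `∫ (∫ f dγ_Λ(· | σ)) γ_{Λ'}(dσ | η) = ∫ f dγ_{Λ'}(· | η)` (Mathlib `Kernel.integral_comp` for the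
kernel `γ_Λ`). [cite: Georgii2011, Def. 1.23 (iii)] -/
theorem IsSpecification.integral_integral_consistent (hγ : IsSpecification γ) {Λ Λ' : Finset V}
    (hsub : Λ ⊆ Λ') (η : V → S) {f : (V → S) → ℝ} (hf : Integrable f (γ Λ' η)) :
    ∫ σ, ∫ τ, f τ ∂(γ Λ σ) ∂(γ Λ' η) = ∫ τ, f τ ∂(γ Λ' η) := by
  let κ : Kernel (V → S) (V → S) := ⟨γ Λ, hγ.measurable_fun Λ⟩
  have hbind : (γ Λ' η).bind (γ Λ) = γ Λ' η := by
    ext A hA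
    rw [Measure.bind_apply hA (hγ.measurable_fun Λ).aemeasurable]
    exact hγ.consistent hsub η A hA
  have hcomp : (κ ∘ₖ Kernel.const Unit (γ Λ' η)) () = γ Λ' η := by
    rw [Kernel.comp_apply, Kernel.const_apply]
    exact hbind
  have hfi : Integrable f ((κ ∘ₖ Kernel.const Unit (γ Λ' η)) ()) := by rwa [hcomp]
  have key := Kernel.integral_comp hfi
  rw [hcomp, Kernel.const_apply] at key
  exact key.symm

end Consistency

/-! ### The dusting data of the O(N) model -/

section Data

variable (G : SimpleGraph V) [DecidableEq V] [G.LocallyFinite] [DecidableRel G.Adj] [NeZero N]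

omit [DecidableEq V] [G.LocallyFinite] [DecidableRel G.Adj] [NeZero N] in
/-- **Dobrushin's influence coefficient of the O(N) model**, `C(β) = e^{4|β|} - 1`: an upper bound
for `c_{xy}(π)` between neighbours (Friedli–Velenik 2017, Thm. 6.35 / Example 6.36 give the sharper
`2β`-type bound for `±1` spins; Georgii 2011, Prop. 8.8). [cite: FriedliVelenik2017, Thm. 6.35] -/
def onDobrushinCoeff (β : ℝ) : ℝ := Real.exp (4 * |β|) - 1

omit [DecidableEq V] [G.LocallyFinite] [DecidableRel G.Adj] [NeZero N] in
/-- `C(β) ≥ 0`. [folklore] -/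
theorem onDobrushinCoeff_nonneg (β : ℝ) : 0 ≤ onDobrushinCoeff β := by
  unfold onDobrushinCoeff
  linarith [Real.one_le_exp (by positivity : 0 ≤ 4 * |β|)]

omit [DecidableEq V] [NeZero N] in
/-- A bounded measurable observable is integrable for every probability measure. [folklore] -/
theorem integrable_of_abs_le {μ : Measure (ONConfig V N)} [IsFiniteMeasure μ]
    {f : ONConfig V N → ℝ} (hfm : Measurable f) {M : ℝ} (hM : ∀ σ, |f σ| ≤ M) : Integrable f μ :=
  Integrable.of_bound hfm.aestronglyMeasurable M (ae_of_all _ fun σ => by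
    rw [Real.norm_eq_abs]; exact hM σ)

/-- **The dusting data of the O(N) model** (Friedli–Velenik 2017, §6.5.2–6.5.3; Georgii 2011,
§8.1): admissible observables are the bounded measurable local functions, the averaging
operators are the one-vertex kernels `T_x = γ_x` (`onSiteAvg`), the influence coefficients are
`C(β) 𝟙[x ∼ y]`, and the dusting estimate is `isOscBound_onSiteAvg`. The set `W` of usable sites is
a parameter. [cite: FriedliVelenik2017, Lemma 6.34] -/
def onDustingData (β : ℝ) (W : Set V) : Dobrushin.DustingData V (SphereSpin N) where
  P f Δ := Measurable f ∧ DependsOn f (↑Δ : Set V) ∧ ∃ M, ∀ σ, |f σ| ≤ M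
  T x f := onSiteAvg G β x f
  C x y := if G.Adj x y then onDobrushinCoeff β else 0
  nbr x := G.neighborFinset x
  W := W
  dependsOn_of h := h.2.1
  exists_of {f Δ} x _ h := ⟨Δ ∪ G.neighborFinset x, measurable_onSiteAvg G β x h.1,
    dependsOn_onSiteAvg G β x h.1 h.2.1,
    h.2.2.imp fun M hM σ => abs_onSiteAvg_le G β x hM σ⟩
  C_nonneg x y := by
    split_ifs
    · exact onDobrushinCoeff_nonneg β
    · exact le_rfl
  C_eq_zero x y hy := if_neg (by simpa [SimpleGraph.mem_neighborFinset] using hy)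
  dust {f Δ δ} x _ hf hδ := by
    obtain ⟨hfm, -, M, hM⟩ := hf
    exact isOscBound_onSiteAvg G β x hfm hM hδ

/-- The row sums of the influence coefficients are `deg(x) C(β)`. [cite: FriedliVelenik2017, Example 6.36] -/
theorem sum_onDustingCoeff_eq (β : ℝ) (W : Set V) (x : V) :
    ∑ y ∈ (onDustingData G β W (N := N)).nbr x, (onDustingData G β W (N := N)).C x y =
      G.degree x * onDobrushinCoeff β := by
  change ∑ y ∈ G.neighborFinset x, (if G.Adj x y then onDobrushinCoeff β else 0) = _
  rw [Finset.sum_ite_of_true (fun y hy => (SimpleGraph.mem_neighborFinset _ _ _).1 hy),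
    Finset.sum_const, nsmul_eq_mul, SimpleGraph.card_neighborFinset_eq_degree]

/-- On a graph with degrees `≤ D`, Dobrushin's constant of the O(N) model is at most
`D (e^{4|β|} - 1)` (Friedli–Velenik 2017, Example 6.36: `c(π) ≤ 2d · 2β` for the Ising model;
Georgii 2011, Prop. 8.8). [cite: FriedliVelenik2017, Example 6.36] -/
theorem sum_onDustingCoeff_le (β : ℝ) (W : Set V) {D : ℕ} (hdeg : ∀ x, G.degree x ≤ D) (x : V) :
    ∑ y ∈ (onDustingData G β W (N := N)).nbr x, (onDustingData G β W (N := N)).C x y ≤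
      D * onDobrushinCoeff β := by
  rw [sum_onDustingCoeff_eq]
  exact mul_le_mul_of_nonneg_right (by exact_mod_cast hdeg x) (onDobrushinCoeff_nonneg β)

/-! ### Invariant states -/

/-- **A Gibbs measure is an invariant state** for the dusting data (any `W`): its expectation is
monotone-normalised and `μ(γ_x f) = μ(f)` by the DLR equations (Friedli–Velenik 2017, proof of
Thm. 6.31, `|μ(f) - ν(f)| = |μπ_Λ(f) - νπ_Λ(f)|`; Georgii 2011, Thm. 8.7).
[cite: FriedliVelenik2017, Thm. 6.31] -/
theorem isInvariantState_integral_of_isGibbsMeasure [Countable V] (β : ℝ) (W : Set V)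
    {μ : Measure (ONConfig V N)} (hμ : IsGibbsMeasure (onSpecification G β) μ) :
    (onDustingData G β W).IsInvariantState fun f => ∫ σ, f σ ∂μ := by
  haveI := hμ.isProbabilityMeasure
  refine ⟨fun {f Δ M} hf hM => ?_, fun {f Δ m} hf hm => ?_, fun {f Δ} x _ hf => ?_⟩
  · obtain ⟨hfm, -, B, hB⟩ := hf
    calc ∫ σ, f σ ∂μ ≤ ∫ _σ, M ∂μ := integral_mono (integrable_of_abs_le hfm hB)
          (integrable_const M) hM
      _ = M := by simp
  · obtain ⟨hfm, -, B, hB⟩ := hf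
    calc m = ∫ _σ, m ∂μ := by simp
      _ ≤ ∫ σ, f σ ∂μ := integral_mono (integrable_const m) (integrable_of_abs_le hfm hB) hm
  · obtain ⟨hfm, -, B, hB⟩ := hf
    exact hμ.integral_integral_eq (isSpecification_onSpecification_countable G β) {x}
      (integrable_of_abs_le hfm hB)

/-- **A finite-volume kernel is an invariant state with `W` its volume**: for `x ∈ Λ'`,
`γ_{Λ'}(γ_x f | η₀) = γ_{Λ'}(f | η₀)` by consistency (Georgii 2011, Def. 1.23 (iii); this is the
input of the comparison of two finite-volume Gibbs distributions, Georgii 2011, Thm. 8.20 /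
Remark 8.26). [cite: Georgii2011, Thm. 8.20] -/
theorem isInvariantState_integral_onSpecification [Countable V] (β : ℝ) (Λ' : Finset V)
    (η₀ : ONConfig V N) :
    (onDustingData G β (↑Λ' : Set V)).IsInvariantState
      fun f => ∫ σ, f σ ∂(onSpecification G β Λ' η₀) := by
  haveI : IsProbabilityMeasure (onSpecification G β Λ' η₀) := by
    rw [onSpecification_apply]; infer_instance
  refine ⟨fun {f Δ M} hf hM => ?_, fun {f Δ m} hf hm => ?_, fun {f Δ} x hx hf => ?_⟩
  · obtain ⟨hfm, -, B, hB⟩ := hf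
    calc ∫ σ, f σ ∂(onSpecification G β Λ' η₀) ≤ ∫ _σ, M ∂(onSpecification G β Λ' η₀) :=
          integral_mono (integrable_of_abs_le hfm hB) (integrable_const M) hM
      _ = M := by simp
  · obtain ⟨hfm, -, B, hB⟩ := hf
    calc m = ∫ _σ, m ∂(onSpecification G β Λ' η₀) := by simp
      _ ≤ ∫ σ, f σ ∂(onSpecification G β Λ' η₀) :=
          integral_mono (integrable_const m) (integrable_of_abs_le hfm hB) hm
  · obtain ⟨hfm, -, B, hB⟩ := hf
    exact (isSpecification_onSpecification_countable G β).integral_integral_consistent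
      (Finset.singleton_subset_iff.2 hx) η₀ (integrable_of_abs_le hfm hB)

/-- **Tilting a Gibbs measure by a nonnegative local density gives an invariant state off the
support of the density**: for `g ≥ 0` bounded measurable depending only on the spins in `Δ_g` and
`x ∉ Δ_g`, `μ(g · γ_x f) = μ(γ_x (g f)) = μ(g f)` by properness and the DLR equations (the device
behind the covariance estimates in Dobrushin's regime, Georgii 2011, §8.2, Thm. 8.20 and
Cor. 8.32 ff.; Künsch 1982). [cite: Georgii2011, Thm. 8.20] -/
theorem isInvariantState_tilt [Countable V] (β : ℝ) {μ : Measure (ONConfig V N)}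
    (hμ : IsGibbsMeasure (onSpecification G β) μ) {g : ONConfig V N → ℝ} (hgm : Measurable g)
    {Δg : Finset V} (hgdep : DependsOn g (↑Δg : Set V)) (hg0 : ∀ σ, 0 ≤ g σ) {B : ℝ}
    (hgB : ∀ σ, g σ ≤ B) (hgpos : 0 < ∫ σ, g σ ∂μ) :
    (onDustingData G β ((↑Δg : Set V)ᶜ)).IsInvariantState
      fun f => (∫ σ, g σ * f σ ∂μ) / ∫ σ, g σ ∂μ := by
  haveI := hμ.isProbabilityMeasure
  have hgabs : ∀ σ, |g σ| ≤ B := fun σ => by rw [abs_of_nonneg (hg0 σ)]; exact hgB σ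
  have hgi : Integrable g μ := integrable_of_abs_le hgm hgabs
  have hgfi : ∀ {f : ONConfig V N → ℝ}, Measurable f → ∀ {M : ℝ}, (∀ σ, |f σ| ≤ M) →
      Integrable (fun σ => g σ * f σ) μ := fun hfm M hM =>
    hgi.mul_bdd hfm.aestronglyMeasurable (ae_of_all _ fun σ => by
      rw [Real.norm_eq_abs]; exact hM σ)
  refine ⟨fun {f Δ M} hf hM => ?_, fun {f Δ m} hf hm => ?_, fun {f Δ} x hx hf => ?_⟩
  · obtain ⟨hfm, -, B', hB'⟩ := hf
    rw [div_le_iff₀ hgpos]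
    calc ∫ σ, g σ * f σ ∂μ ≤ ∫ σ, g σ * M ∂μ :=
          integral_mono (hgfi hfm hB') (hgi.mul_const M)
            fun σ => mul_le_mul_of_nonneg_left (hM σ) (hg0 σ)
      _ = M * ∫ σ, g σ ∂μ := by rw [integral_mul_const, mul_comm]
  · obtain ⟨hfm, -, B', hB'⟩ := hf
    rw [le_div_iff₀ hgpos]
    calc m * ∫ σ, g σ ∂μ = ∫ σ, g σ * m ∂μ := by rw [integral_mul_const, mul_comm]
      _ ≤ ∫ σ, g σ * f σ ∂μ :=
          integral_mono (hgi.mul_const m) (hgfi hfm hB')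
            fun σ => mul_le_mul_of_nonneg_left (hm σ) (hg0 σ)
  · obtain ⟨hfm, -, B', hB'⟩ := hf
    have hγ := isSpecification_onSpecification_countable (N := N) G β
    have hxΔ : x ∉ Δg := fun h => hx (Finset.mem_coe.2 h)
    -- `g` is blind to the spin at `x`, so it commutes with `γ_x` (properness)
    have hpt : ∀ η, g η * onSiteAvg G β x f η =
        ∫ σ, g σ * f σ ∂(onSpecification G β {x} η) := fun η => by
      rw [onSiteAvg, ← integral_const_mul]
      refine integral_congr_ae ?_
      filter_upwards [hγ.proper {x} η] with σ hσ
      rw [hgdep fun i hi => (hσ i fun hix => hxΔ ?_).symm]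
      rwa [Finset.mem_singleton.1 hix] at hi
    change (∫ σ, g σ * onSiteAvg G β x f σ ∂μ) / ∫ σ, g σ ∂μ = (∫ σ, g σ * f σ ∂μ) / ∫ σ, g σ ∂μ
    congr 1
    simp_rw [hpt]
    exact hμ.integral_integral_eq hγ {x} (hgfi hfm hB')

/-! ### Uniqueness -/

/-- **Two Gibbs measures agree on bounded local observables in Dobrushin's regime**
(Friedli–Velenik 2017, Thm. 6.31 with Example 6.36; Georgii 2011, Thm. 8.7 with Prop. 8.8): on a
graph with degrees `≤ D` and `D (e^{4|β|} - 1) < 1`, for any two Gibbs measures of the O(N)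
specification and every bounded measurable `f` depending on finitely many spins, `μ(f) = ν(f)`.
[cite: FriedliVelenik2017, Thm. 6.31] -/
theorem integral_eq_of_isGibbsMeasure [Countable V] (β : ℝ) {D : ℕ} (hdeg : ∀ x, G.degree x ≤ D)
    (hβ : D * onDobrushinCoeff β < 1) {μ ν : Measure (ONConfig V N)}
    (hμ : IsGibbsMeasure (onSpecification G β) μ) (hν : IsGibbsMeasure (onSpecification G β) ν)
    {f : ONConfig V N → ℝ} (hfm : Measurable f) {Δ : Finset V} (hdep : DependsOn f (↑Δ : Set V))
    {M : ℝ} (hM : ∀ σ, |f σ| ≤ M) :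
    ∫ σ, f σ ∂μ = ∫ σ, f σ ∂ν := by
  have hM0 : 0 ≤ max M 0 := le_max_right _ _
  have hM' : ∀ σ, |f σ| ≤ max M 0 := fun σ => (hM σ).trans (le_max_left _ _)
  exact (onDustingData G β Set.univ).eq_of_lt_one
    (isInvariantState_integral_of_isGibbsMeasure G β Set.univ hμ)
    (isInvariantState_integral_of_isGibbsMeasure G β Set.univ hν)
    (mul_nonneg (Nat.cast_nonneg D) (onDobrushinCoeff_nonneg β)) hβ (fun _ => Set.mem_univ _)
    (sum_onDustingCoeff_le G β Set.univ hdeg) (f := f) (Δ := Δ) ⟨hfm, hdep, max M 0, hM'⟩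
    (Dobrushin.IsOscBound.of_abs_le hM0 hM')

/-- **Equality of Gibbs measures in Dobrushin's regime**: probability measures agreeing on the
indicators of measurable cylinders agree (Friedli–Velenik 2017, Lemma 6.22 / proof of Thm. 6.31:
"since this holds for all local functions, `μ = ν`"; Mathlib `generateFrom_measurableCylinders`,
`isPiSystem_measurableCylinders`). [cite: FriedliVelenik2017, Thm. 6.31] -/
theorem measure_eq_of_isGibbsMeasure [Countable V] (β : ℝ) {D : ℕ} (hdeg : ∀ x, G.degree x ≤ D)
    (hβ : D * onDobrushinCoeff β < 1) {μ ν : Measure (ONConfig V N)}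
    (hμ : IsGibbsMeasure (onSpecification G β) μ) (hν : IsGibbsMeasure (onSpecification G β) ν) :
    μ = ν := by
  haveI := hμ.isProbabilityMeasure
  haveI := hν.isProbabilityMeasure
  refine ext_of_generate_finite (measurableCylinders fun _ : V => SphereSpin N)
    generateFrom_measurableCylinders.symm isPiSystem_measurableCylinders (fun A hA => ?_)
    (by simp)
  obtain ⟨Δ, S, hS, rfl⟩ := (mem_measurableCylinders _).1 hA
  have hAm : MeasurableSet (cylinder Δ S : Set (ONConfig V N)) := MeasurableSet.cylinder Δ hS
  have hind : Measurable ((cylinder Δ S : Set (ONConfig V N)).indicator fun _ => (1 : ℝ)) :=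
    measurable_const.indicator hAm
  have hdep : DependsOn ((cylinder Δ S : Set (ONConfig V N)).indicator fun _ => (1 : ℝ))
      (↑Δ : Set V) :=
    dependsOn_cylinder_indicator_const (α := fun _ : V => SphereSpin N) (I := Δ) S (1 : ℝ)
  have hbd : ∀ σ, |(cylinder Δ S : Set (ONConfig V N)).indicator (fun _ => (1 : ℝ)) σ| ≤ 1 :=
    fun σ => by
      by_cases hσ : σ ∈ (cylinder Δ S : Set (ONConfig V N))
      · rw [Set.indicator_of_mem hσ]; simp
      · rw [Set.indicator_of_notMem hσ]; simp
  have h := integral_eq_of_isGibbsMeasure G β hdeg hβ hμ hν hind hdep hbd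
  rw [integral_indicator_const _ hAm, integral_indicator_const _ hAm, smul_eq_mul, smul_eq_mul,
    mul_one, mul_one] at h
  exact (measureReal_eq_measureReal_iff (measure_ne_top μ _) (measure_ne_top ν _)).1 h

/-- **Dobrushin's uniqueness theorem for the O(N) model** (Dobrushin 1968; Friedli–Velenik 2017,
Thm. 6.31 with Example 6.36; Georgii 2011, Thm. 8.7 with Prop. 8.8): on a locally finite graph with
countable vertex set and degrees `≤ D`, if `D (e^{4|β|} - 1) < 1` then the O(N) specification at
inverse temperature `β` admits at most one Gibbs measure. [cite: FriedliVelenik2017, Thm. 6.31] -/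
theorem subsingleton_gibbsMeasures_onSpecification [Countable V] (β : ℝ) {D : ℕ}
    (hdeg : ∀ x, G.degree x ≤ D) (hβ : D * onDobrushinCoeff β < 1) :
    (gibbsMeasures (onSpecification (N := N) G β)).Subsingleton :=
  fun _ hμ _ hν => measure_eq_of_isGibbsMeasure G β hdeg hβ hμ hν

end Data

end Literature.Probability.LatticeModels
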